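import Literature.MathematicalPhysics.QuantumFieldTheory.Balaban1983to89.T4CouplingMatching
import Literature.MathematicalPhysics.QuantumFieldTheory.Balaban1983to89.T4BetaFlowWellPosed

/-!
# EriceRemainderEnclosureHistoryRenewalWitness — (E35a) the β-LEVEL WITNESS for the rate row, part 1: the DIGITAL stationary additive
# family — amplitudes, accumulated firing, the two recursion grids, and the SEPARATION of run B's designated read points from every other
# point either run reads (so that finitely many TENT profiles of the past couplings fire exactly where designed)

Cell `pub-balaban`, β-function sub-cell, BINDER row D4 «RemainderConst leaves for Bałaban's split» (`HOME/BINDER-OWNERS.md`; owner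
lineage `b2b-balaban-beta-an4`; this file by co-owner #2 lineage `b2b-balaban-beta-d4-p2`, generation 37), β-FLOW TEAM duty (1),
FREEZE (0) honoured (def-free: every object is a bound variable with a defining hypothesis; no new leaf, no new hypothesis shape).
Part 1 of station (E35); part 2 `EriceRemainderEnclosureHistoryRenewalWitnessRuns` verifies the run equations and the binder list of
(E33g) and packages the witness; part 3 `EriceRemainderEnclosureHistoryRenewalWitnessRate` chooses the number of stages and concludes.

HONEST FRAMING (page 1, verbatim and binding).  *"Discharging BetaPertH makes Bałaban's UV stability UNCONDITIONAL — a real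
constructive-QFT result; it is NOT the continuum limit and NOT the Clay problem."*  THIS FILE DISCHARGES NOTHING OF THE KIND.  It is
[folklore] real analysis: an EXPLICIT history family `β : FlowStep.HBeta` (a constant Markov part minus finitely many tent profiles of
the past couplings) together with two EXPLICIT runs of (0.20), built to satisfy the cell's NOT-IN-PRINT binders (`ScaleShiftRate`, GAPS
G-t4-U2-1; `HistLipschitz` with k-uniform rows, GAPS G-t4-U2-2; sign ∕ floor) — a WITNESS about what those binders do NOT imply.  Nothing
of Bałaban's [I] (1.22) is quoted newly, typed or asserted (loci verbatim in the headers of `FlowStep` ∕ `T4CouplingMatching`).  Row D4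
class UNCHANGED (critical-path width 0; instance 0∕1; D4 DISCHARGE NO DATE); NOT B12 Thm 2, NOT BetaPertH, NOT continuum, NOT Clay.
HONEST DEPENDENCY: continuum YM on T⁴ ⇐ BetaPertH ∧ nine spine estimates (0/9 proved); BetaPertH ⇐ (D1) ∧ (D4) ∧ CAP+tail; G-an2-4
gates asym, D1 and NE2/3/4.

THE POINT (census sense (α), the history channel's RATE row after (E33)∕(E34)).  (E33g) `disc_le_sqrt_uniform_sign` bounds the two-run
coupling discrepancy of node U2 WITHOUT `FadingMemory` by a K-uniform STRETCHED exponential `L·ρ^⌊√j⌋`; (E34) showed that no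
GEOMETRIC rate follows THROUGH THE ROW SYSTEM and left the β-level question open: does an admissible history family actually defeat
the geometric shape?  Station (E35) answers YES with the DIGITAL DESIGN of this file.  Run A (cutoff `K`) is kept TRIVIAL — it sits on
the grid `1∕(g^A_i)² = Y(K − i)`, `Y m = x⋆ + B₀·m` — and run B (cutoff `K + 1`) FIRES: `1∕(g^B_i)² = Y(K + 1 − i) − W i` with the
accumulated firing `W i = Σ_{t : i ≤ k_t + 1} ε_t` of `s + 1` stages (ages `a_t`, rows `k_t`, amplitudes `ε_t = cθ^{a_t−1}∕(s+1)`,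
`a_0 = k_0 + 1`: the seed reads run B's BARE coupling, which run A never reads; `k_{t+1} = k_t + a_{t+1}`: stage `t + 1` reads the row
of stage `t`, where the two runs already differ by `W ≥ ε_t`).  The family is `β_{k+1}(v) = B₀ − Σ_t [a_t ≤ k]·ε_t·tent_t(v_{k−a_t})`
with the tent of stage `t` CENTRED at run B's designated read point and of slope `L_t = (1 + Ytop)³∕η_t` (`η_0 = b`, `η_{t+1} = ε_t`)
— steep enough to VANISH at every other point either run reads (§2 `tentA_zero` ∕ `tentB_zero`: distinct grid indices differ by
`≥ B₀ − S = b` in the recursion variable, the same index differs by the firing `W ≥ ε_{t−1}`, and `|y₁ − y₂| ≤ (1 + Ytop)³·|g₁ − g₂|`).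
The explicit runs then solve (0.20) BY INSPECTION (part 2) — no fixed point, no tuning to unknown run points: the «B^{(K)} = A^{(K+1)}»
obstruction recorded by gen 36 does not arise because only ONE pair of cutoffs is needed for each target `(C, κ)`.

WHAT IS PROVED (0 `def`, 0 sorry; [folklore]; the `1∕√y` helpers are node U2's `T4BetaFlowWellPosed` ones, by name).  §1 kit:
`abs_sub_le_cube_mul_abs_invSqrt_sub` (separation in the coupling variable), tents (`tent_nonneg` ∕ `tent_le_one` ∕ `tent_self` ∕
`tent_eq_zero` ∕ `abs_tent_sub_tent_le`).  §2 data: `eps_pos` ∕ `eps_le` ∕ `sum_eps_bounds` (`0 ≤ S ≤ c`), `W_bounds` ∕ `eps_le_W` ∕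
`W_eq_zero`, `grid_bounds`, `run_values` (both runs' recursion values lie in `[x⋆, Ytop]`), and the separation theorems `tentA_zero`,
`tentB_zero`.
-/

noncomputable section
open Finset

namespace Summit.QuantumFields.BalabanUV.Beta.EriceRemainderEnclosureHistoryRenewalWitness

open Literature.MathematicalPhysics.QuantumFieldTheory.Balaban1983to89
open Literature.MathematicalPhysics.QuantumFieldTheory.Balaban1983to89.FlowStep
open Literature.MathematicalPhysics.QuantumFieldTheory.Balaban1983to89.T4CouplingMatching
open Literature.MathematicalPhysics.QuantumFieldTheory.Balaban1983to89.T4BetaFlowWellPosed (one_div_sqrt_le)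
open Literature.MathematicalPhysics.QuantumFieldTheory.Balaban1983to89.T4BetaFlowWellPosed.Sharpness (one_div_sqrt_pos one_div_one_div_sqrt_sq)

/-! ## §1 Elementary kit: separation in the coupling variable `g = 1∕√y`, and tent profiles -/

/-- SEPARATION IN THE COUPLING VARIABLE: for `0 < y₁, y₂ ≤ Y`, `|y₁ − y₂| ≤ (1 + Y)³ · |1∕√y₁ − 1∕√y₂|` — two recursion values that
differ by `η` give couplings that differ by at least `η ∕ (1 + Y)³`. [folklore] -/
theorem abs_sub_le_cube_mul_abs_invSqrt_sub {y₁ y₂ Y : ℝ} (h1 : 0 < y₁) (h2 : 0 < y₂) (h1Y : y₁ ≤ Y) (h2Y : y₂ ≤ Y) :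
    |y₁ - y₂| ≤ (1 + Y) ^ 3 * |1 / Real.sqrt y₁ - 1 / Real.sqrt y₂| := by
  have hs1 : 0 < Real.sqrt y₁ := Real.sqrt_pos.mpr h1
  have hs2 : 0 < Real.sqrt y₂ := Real.sqrt_pos.mpr h2
  have hY1 : 0 < 1 + Y := by linarith
  -- AM–GM: 2√y ≤ 1 + y ≤ 1 + Y
  have hb1 : 2 * Real.sqrt y₁ ≤ 1 + Y := by nlinarith [Real.sq_sqrt h1.le, sq_nonneg (Real.sqrt y₁ - 1)]
  have hb2 : 2 * Real.sqrt y₂ ≤ 1 + Y := by nlinarith [Real.sq_sqrt h2.le, sq_nonneg (Real.sqrt y₂ - 1)]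
  have e : y₁ - y₂ = (Real.sqrt y₁ * Real.sqrt y₂ * (Real.sqrt y₁ + Real.sqrt y₂)) *
      -(1 / Real.sqrt y₁ - 1 / Real.sqrt y₂) := by
    field_simp
    nlinarith [Real.sq_sqrt h1.le, Real.sq_sqrt h2.le]
  have hP : 0 ≤ Real.sqrt y₁ * Real.sqrt y₂ * (Real.sqrt y₁ + Real.sqrt y₂) := by positivity
  have hm : (2 * Real.sqrt y₁) * (2 * Real.sqrt y₂) ≤ (1 + Y) * (1 + Y) :=
    mul_le_mul hb1 hb2 (by positivity) hY1.le
  have hPle : Real.sqrt y₁ * Real.sqrt y₂ * (Real.sqrt y₁ + Real.sqrt y₂) ≤ (1 + Y) ^ 3 := by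
    have h3 : ((2 * Real.sqrt y₁) * (2 * Real.sqrt y₂)) * (2 * Real.sqrt y₁ + 2 * Real.sqrt y₂)
        ≤ ((1 + Y) * (1 + Y)) * ((1 + Y) + (1 + Y)) :=
      mul_le_mul hm (add_le_add hb1 hb2) (by positivity) (by positivity)
    nlinarith [pow_pos hY1 3]
  rw [e, abs_mul, abs_neg, abs_of_nonneg hP]
  exact mul_le_mul_of_nonneg_right hPle (abs_nonneg _)

/-- Tent profiles are nonnegative. [folklore] -/
theorem tent_nonneg (L p x : ℝ) : 0 ≤ max 0 (1 - L * |x - p|) := le_max_left _ _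

/-- Tent profiles are at most `1` (`L ≥ 0`). [folklore] -/
theorem tent_le_one {L : ℝ} (hL : 0 ≤ L) (p x : ℝ) : max 0 (1 - L * |x - p|) ≤ 1 :=
  max_le zero_le_one (by nlinarith [abs_nonneg (x - p)])

/-- The tent is `1` at its centre. [folklore] -/
theorem tent_self (L p : ℝ) : max 0 (1 - L * |p - p|) = 1 := by simp

/-- The tent vanishes at distance `≥ 1∕L` from its centre. [folklore] -/
theorem tent_eq_zero {L p x : ℝ} (h : 1 ≤ L * |x - p|) : max 0 (1 - L * |x - p|) = 0 :=
  max_eq_left (by linarith)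

/-- The tent of slope `L ≥ 0` is `L`-Lipschitz. [folklore] -/
theorem abs_tent_sub_tent_le {L : ℝ} (hL : 0 ≤ L) (p x y : ℝ) :
    |max 0 (1 - L * |x - p|) - max 0 (1 - L * |y - p|)| ≤ L * |x - y| := by
  have h2 : |(1 - L * |x - p|) - (1 - L * |y - p|)| ≤ L * |x - y| := by
    have e2 : (1 - L * |x - p|) - (1 - L * |y - p|) = L * (|y - p| - |x - p|) := by ring
    rw [e2, abs_mul, abs_of_nonneg hL]
    refine mul_le_mul_of_nonneg_left ?_ hL
    calc |(|y - p| - |x - p|)| ≤ |(y - p) - (x - p)| := abs_abs_sub_abs_le_abs_sub _ _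
      _ = |x - y| := by rw [show (y - p) - (x - p) = -(x - y) by ring, abs_neg]
  rw [max_comm 0 (1 - L * |x - p|), max_comm 0 (1 - L * |y - p|)]
  exact (abs_max_sub_max_le_abs _ _ _).trans h2

/-! ## §2 The digital family: amplitudes, the accumulated firing `W`, the two recursion grids -/

/-- The amplitudes `ε_t = cθ^{a_t−1}∕(s+1)` are positive. [folklore] -/
theorem eps_pos {c θ : ℝ} {s : ℕ} {a : ℕ → ℕ} {ε : ℕ → ℝ} (hc : 0 < c) (hθ0 : 0 < θ)
    (hε : ∀ t, ε t = c * θ ^ (a t - 1) / (s + 1)) (t : ℕ) : 0 < ε t := by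
  rw [hε]; positivity

/-- `ε_t ≤ c∕(s+1)` (`0 ≤ θ ≤ 1`). [folklore] -/
theorem eps_le {c θ : ℝ} {s : ℕ} {a : ℕ → ℕ} {ε : ℕ → ℝ} (hc : 0 ≤ c) (hθ0 : 0 ≤ θ) (hθ1 : θ ≤ 1)
    (hε : ∀ t, ε t = c * θ ^ (a t - 1) / (s + 1)) (t : ℕ) : ε t ≤ c / (s + 1) := by
  rw [hε]
  exact div_le_div_of_nonneg_right (mul_le_of_le_one_right hc (pow_le_one₀ hθ0 hθ1)) (by positivity)

/-- The total amplitude `S = Σ_{t≤s} ε_t` satisfies `0 ≤ S ≤ c`. [folklore] -/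
theorem sum_eps_bounds {c θ : ℝ} {s : ℕ} {a : ℕ → ℕ} {ε : ℕ → ℝ} {S : ℝ} (hc : 0 < c) (hθ0 : 0 < θ) (hθ1 : θ ≤ 1)
    (hε : ∀ t, ε t = c * θ ^ (a t - 1) / (s + 1)) (hS : S = ∑ t ∈ range (s + 1), ε t) : 0 ≤ S ∧ S ≤ c := by
  refine ⟨hS ▸ sum_nonneg fun t _ => (eps_pos hc hθ0 hε t).le, ?_⟩
  rw [hS]
  calc ∑ t ∈ range (s + 1), ε t ≤ ∑ _t ∈ range (s + 1), c / (s + 1) := sum_le_sum fun t _ => eps_le hc.le hθ0.le hθ1 hε t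
    _ = c := by rw [sum_const, card_range, nsmul_eq_mul]; push_cast; field_simp

/-- The accumulated firing `W i = Σ_{t : i ≤ k_t+1} ε_t` lies in `[0, S]`. [folklore] -/
theorem W_bounds {c θ : ℝ} {s : ℕ} {a k : ℕ → ℕ} {ε W : ℕ → ℝ} {S : ℝ} (hc : 0 < c) (hθ0 : 0 < θ)
    (hε : ∀ t, ε t = c * θ ^ (a t - 1) / (s + 1)) (hS : S = ∑ t ∈ range (s + 1), ε t)
    (hW : ∀ i, W i = ∑ t ∈ range (s + 1), if i ≤ k t + 1 then ε t else 0) (i : ℕ) : 0 ≤ W i ∧ W i ≤ S := by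
  have hp := eps_pos hc hθ0 hε
  rw [hW, hS]
  exact ⟨sum_nonneg fun t _ => by split_ifs <;> [exact (hp t).le; exact le_rfl],
    sum_le_sum fun t _ => by split_ifs <;> [exact le_rfl; exact (hp t).le]⟩

/-- One firing term bounds `W` from below: `ε_t ≤ W i` for `t ≤ s`, `i ≤ k_t + 1`. [folklore] -/
theorem eps_le_W {c θ : ℝ} {s : ℕ} {a k : ℕ → ℕ} {ε W : ℕ → ℝ} (hc : 0 < c) (hθ0 : 0 < θ)
    (hε : ∀ t, ε t = c * θ ^ (a t - 1) / (s + 1))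
    (hW : ∀ i, W i = ∑ t ∈ range (s + 1), if i ≤ k t + 1 then ε t else 0) {t i : ℕ} (ht : t ≤ s) (hi : i ≤ k t + 1) :
    ε t ≤ W i := by
  have hp := eps_pos hc hθ0 hε
  rw [hW]
  calc ε t = if i ≤ k t + 1 then ε t else 0 := by rw [if_pos hi]
    _ ≤ ∑ t ∈ range (s + 1), if i ≤ k t + 1 then ε t else 0 :=
      single_le_sum (f := fun t => if i ≤ k t + 1 then ε t else 0)
        (fun t _ => by split_ifs <;> [exact (hp t).le; exact le_rfl]) (mem_range.mpr (by omega))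

/-- Past the last firing row `W` vanishes: `W i = 0` for `i ≥ k_s + 2` when all `k_t ≤ k_s`. [folklore] -/
theorem W_eq_zero {s : ℕ} {k : ℕ → ℕ} {ε W : ℕ → ℝ}
    (hW : ∀ i, W i = ∑ t ∈ range (s + 1), if i ≤ k t + 1 then ε t else 0) (hks : ∀ t, t ≤ s → k t ≤ k s)
    {i : ℕ} (hi : k s + 2 ≤ i) : W i = 0 := by
  rw [hW]
  exact sum_eq_zero fun t ht => by
    have := hks t (by simpa [mem_range, Nat.lt_succ_iff] using ht)
    rw [if_neg (by omega)]

/-- The recursion grid of run A, `Y m = x⋆ + B₀·m` (`x⋆ = 1∕γ²`, `B₀ = b + S`): `x⋆ > 0`, `B₀ ≥ b`, and for `m ≤ k_s + 2` the value lies in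
`[x⋆, Ytop]` with `Ytop = x⋆ + (b + c)(k_s + 2)`. [folklore] -/
theorem grid_bounds {c θ γ b : ℝ} {s : ℕ} {a k : ℕ → ℕ} {ε : ℕ → ℝ} {S B₀ xs Ytop : ℝ} {Y : ℕ → ℝ}
    (hc : 0 < c) (hθ0 : 0 < θ) (hθ1 : θ ≤ 1) (hγ : 0 < γ) (hb : 0 < b)
    (hε : ∀ t, ε t = c * θ ^ (a t - 1) / (s + 1)) (hS : S = ∑ t ∈ range (s + 1), ε t) (hB : B₀ = b + S)
    (hx : xs = 1 / γ ^ 2) (hY : ∀ m : ℕ, Y m = xs + B₀ * m) (hT : Ytop = xs + (b + c) * (k s + 2)) :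
    0 < xs ∧ b ≤ B₀ ∧ B₀ ≤ b + c ∧ (∀ m : ℕ, xs ≤ Y m) ∧ (∀ m : ℕ, m ≤ k s + 2 → Y m ≤ Ytop) ∧
      (∀ m₁ m₂ : ℕ, m₁ ≠ m₂ → B₀ ≤ |Y m₁ - Y m₂|) ∧ (∀ m : ℕ, Y (m + 1) = Y m + B₀) := by
  obtain ⟨hS0, hSc⟩ := sum_eps_bounds hc hθ0 hθ1 hε hS
  have hxs : 0 < xs := by rw [hx]; positivity
  have hB0 : b ≤ B₀ := by rw [hB]; linarith
  have hB1 : B₀ ≤ b + c := by rw [hB]; linarith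
  have hBpos : 0 < B₀ := hb.trans_le hB0
  refine ⟨hxs, hB0, hB1, fun m => ?_, fun m hm => ?_, fun m₁ m₂ hne => ?_, fun m => ?_⟩
  · rw [hY]; nlinarith [Nat.cast_nonneg (α := ℝ) m]
  · rw [hY, hT]
    have : (m : ℝ) ≤ (k s : ℝ) + 2 := by exact_mod_cast hm
    nlinarith
  · rw [hY, hY, show xs + B₀ * (m₁ : ℝ) - (xs + B₀ * m₂) = B₀ * ((m₁ : ℝ) - m₂) by ring, abs_mul, abs_of_pos hBpos]
    have h1 : (1 : ℝ) ≤ |(m₁ : ℝ) - m₂| := by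
      rcases Nat.lt_or_gt_of_ne hne with h | h
      · have : (m₁ : ℝ) + 1 ≤ m₂ := by exact_mod_cast h
        rw [abs_of_nonpos (by linarith)]; linarith
      · have : (m₂ : ℝ) + 1 ≤ m₁ := by exact_mod_cast h
        rw [abs_of_nonneg (by linarith)]; linarith
    nlinarith
  · rw [hY, hY]; push_cast; ring

/-- VALUES OF THE TWO RUNS.  Run A (cutoff `K = k_s + 1`) sits on the grid, `1∕(g^A_i)² = Y(K − i)`; run B (cutoff `K + 1`) sits BELOW it
by the accumulated firing, `1∕(g^B_i)² = Y(K + 1 − i) − W i`; all these values lie in `[x⋆, Ytop]`. [folklore] -/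
theorem run_values {c θ γ b : ℝ} {s K : ℕ} {a k : ℕ → ℕ} {ε W Y : ℕ → ℝ} {S B₀ xs Ytop : ℝ}
    (hc : 0 < c) (hθ0 : 0 < θ) (hθ1 : θ ≤ 1) (hγ : 0 < γ) (hb : 0 < b)
    (hε : ∀ t, ε t = c * θ ^ (a t - 1) / (s + 1)) (hS : S = ∑ t ∈ range (s + 1), ε t) (hB : B₀ = b + S)
    (hx : xs = 1 / γ ^ 2) (hY : ∀ m : ℕ, Y m = xs + B₀ * m) (hK : K = k s + 1)
    (hW : ∀ i, W i = ∑ t ∈ range (s + 1), if i ≤ k t + 1 then ε t else 0) (hT : Ytop = xs + (b + c) * (k s + 2))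
    (hks : ∀ t, t ≤ s → k t ≤ k s) (i : ℕ) :
    (xs ≤ Y (K - i) ∧ Y (K - i) ≤ Ytop) ∧ (xs ≤ Y (K + 1 - i) - W i ∧ Y (K + 1 - i) - W i ≤ Ytop) := by
  obtain ⟨hxs, hB0, -, hYlo, hYhi, -, -⟩ := grid_bounds hc hθ0 hθ1 hγ hb hε hS hB hx hY hT
  obtain ⟨hW0, hWS⟩ := W_bounds (k := k) hc hθ0 hε hS hW i
  refine ⟨⟨hYlo _, hYhi _ (by omega)⟩, ?_, by linarith [hYhi (K + 1 - i) (by omega)]⟩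
  by_cases hi : i ≤ K
  · have h1 : (1 : ℝ) ≤ ((K + 1 - i : ℕ) : ℝ) := by exact_mod_cast (show 1 ≤ K + 1 - i by omega)
    rw [hY]
    have : S < B₀ := by rw [hB]; linarith
    nlinarith [hb.trans_le hB0]
  · rw [W_eq_zero hW hks (show k s + 2 ≤ i by omega)]
    linarith [hYlo (K + 1 - i)]

/-- **SEPARATION, RUN A.**  The tent of stage `t` (slope `L_t = (1 + Ytop)³∕η_t`, `η_0 = b`, `η_{t+1} = ε_t`, centred at run B's
designated read point `g^B_{k_t+1−a_t}`) VANISHES at every point of run A that the family reads through age `a_t` (`i + a_t < K`): in the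
recursion variable the two points differ by `W ≥ ε_{t−1}` (same grid index, `t ≥ 1`) or by at least `B₀ − S = b` (different grid index),
and `|y₁ − y₂| ≤ (1 + Ytop)³·|g₁ − g₂|`. [folklore] -/
theorem tentA_zero {c θ γ b : ℝ} {s K : ℕ} {a k : ℕ → ℕ} {ε W Y η L gA gB : ℕ → ℝ} {S B₀ xs Ytop : ℝ}
    (hc : 0 < c) (hθ0 : 0 < θ) (hθ1 : θ ≤ 1) (hγ : 0 < γ) (hb : 0 < b)
    (hε : ∀ t, ε t = c * θ ^ (a t - 1) / (s + 1)) (hS : S = ∑ t ∈ range (s + 1), ε t) (hB : B₀ = b + S)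
    (hx : xs = 1 / γ ^ 2) (hY : ∀ m : ℕ, Y m = xs + B₀ * m) (hK : K = k s + 1)
    (hW : ∀ i, W i = ∑ t ∈ range (s + 1), if i ≤ k t + 1 then ε t else 0) (hT : Ytop = xs + (b + c) * (k s + 2))
    (hη0 : η 0 = b) (hηs : ∀ t, η (t + 1) = ε t) (hL : ∀ t, L t = (1 + Ytop) ^ 3 / η t)
    (hgA : ∀ i, gA i = 1 / Real.sqrt (Y (K - i))) (hgB : ∀ i, gB i = 1 / Real.sqrt (Y (K + 1 - i) - W i))
    (ha0 : a 0 = k 0 + 1) (hak : ∀ t, t < s → k (t + 1) = k t + a (t + 1)) (hks : ∀ t, t ≤ s → k t ≤ k s)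
    (hka : ∀ t, t ≤ s → a t ≤ k t + 1) (hεb : ∀ t, t ≤ s → ε t ≤ b)
    {t : ℕ} (ht : t ≤ s) {i : ℕ} (hiK : i + a t < K) :
    max 0 (1 - L t * |gA i - gB (k t + 1 - a t)|) = 0 := by
  obtain ⟨hxs, hB0, hB1, hYlo, hYhi, hYsep, hYsucc⟩ := grid_bounds hc hθ0 hθ1 hγ hb hε hS hB hx hY hT
  have hV := run_values hc hθ0 hθ1 hγ hb hε hS hB hx hY hK hW hT hks
  have hp := eps_pos hc hθ0 hε
  -- the separating distance η_t and its two bounds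
  have hη : 0 < η t ∧ η t ≤ b ∧ (∀ t', t = t' + 1 → η t = ε t') := by
    cases t with
    | zero => rw [hη0]; exact ⟨hb, le_rfl, fun t' h => absurd h (by omega)⟩
    | succ t₁ => rw [hηs]; exact ⟨hp _, hεb _ (by omega), fun t' h => by rw [show t₁ = t' by omega]⟩
  obtain ⟨hηpos, hηb, hηε⟩ := hη
  set it := k t + 1 - a t with hit
  -- y-level separation
  have hsep : η t ≤ |Y (K - i) - (Y (K + 1 - it) - W it)| := by
    obtain ⟨hW0, hWS⟩ := W_bounds (k := k) hc hθ0 hε hS hW it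
    by_cases hik : i + a t = k t
    · -- same grid index: t ≥ 1 and the difference is W(k_{t-1}+1) ≥ ε_{t-1}
      have ht0 : t ≠ 0 := by rintro rfl; omega
      obtain ⟨t', rfl⟩ : ∃ t', t = t' + 1 := ⟨t - 1, by omega⟩
      have hkt := hak t' (by omega)
      have e1 : K - i = K + 1 - it := by omega
      rw [e1, show Y (K + 1 - it) - (Y (K + 1 - it) - W it) = W it by ring, abs_of_nonneg hW0, hηε t' rfl]
      exact eps_le_W hc hθ0 hε hW (by omega) (by omega)
    · have hne : K - i ≠ K + 1 - it := by
        have := hka t ht; have := hks t ht; omega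
      have h1 := hYsep _ _ hne
      have h2 : |Y (K - i) - (Y (K + 1 - it) - W it)| ≥ |Y (K - i) - Y (K + 1 - it)| - W it := by
        rw [show Y (K - i) - (Y (K + 1 - it) - W it) = (Y (K - i) - Y (K + 1 - it)) + W it by ring]
        have := abs_add_le (Y (K - i) - Y (K + 1 - it) + W it) (-W it)
        rw [add_neg_cancel_right, abs_neg, abs_of_nonneg hW0] at this
        linarith
      have : S = B₀ - b := by rw [hB]; ring
      linarith
  -- g-level separation
  have hy1 := (hV i).1
  have hy2 := (hV it).2
  have hcube := abs_sub_le_cube_mul_abs_invSqrt_sub (hxs.trans_le hy1.1) (hxs.trans_le hy2.1) hy1.2 hy2.2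
  refine tent_eq_zero ?_
  rw [hL, hgA, hgB, div_mul_eq_mul_div, le_div_iff₀ hηpos, one_mul]
  exact hsep.trans hcube

/-- **SEPARATION, RUN B.**  The tent of stage `t` vanishes at every read point of run B other than the designated one: different grid
indices differ by at least `B₀` on the grid and by at most `S` through the accumulated firing, `B₀ − S = b ≥ η_t`. [folklore] -/
theorem tentB_zero {c θ γ b : ℝ} {s K : ℕ} {a k : ℕ → ℕ} {ε W Y η L gB : ℕ → ℝ} {S B₀ xs Ytop : ℝ}
    (hc : 0 < c) (hθ0 : 0 < θ) (hθ1 : θ ≤ 1) (hγ : 0 < γ) (hb : 0 < b)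
    (hε : ∀ t, ε t = c * θ ^ (a t - 1) / (s + 1)) (hS : S = ∑ t ∈ range (s + 1), ε t) (hB : B₀ = b + S)
    (hx : xs = 1 / γ ^ 2) (hY : ∀ m : ℕ, Y m = xs + B₀ * m) (hK : K = k s + 1)
    (hW : ∀ i, W i = ∑ t ∈ range (s + 1), if i ≤ k t + 1 then ε t else 0) (hT : Ytop = xs + (b + c) * (k s + 2))
    (hη0 : η 0 = b) (hηs : ∀ t, η (t + 1) = ε t) (hL : ∀ t, L t = (1 + Ytop) ^ 3 / η t)
    (hgB : ∀ i, gB i = 1 / Real.sqrt (Y (K + 1 - i) - W i))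
    (hks : ∀ t, t ≤ s → k t ≤ k s) (hεb : ∀ t, t ≤ s → ε t ≤ b)
    {t : ℕ} (ht : t ≤ s) {i : ℕ} (hiK : i ≤ K + 1) (hne : i ≠ k t + 1 - a t) :
    max 0 (1 - L t * |gB i - gB (k t + 1 - a t)|) = 0 := by
  obtain ⟨hxs, hB0, hB1, hYlo, hYhi, hYsep, hYsucc⟩ := grid_bounds hc hθ0 hθ1 hγ hb hε hS hB hx hY hT
  have hV := run_values hc hθ0 hθ1 hγ hb hε hS hB hx hY hK hW hT hks
  have hp := eps_pos hc hθ0 hε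
  have hη : 0 < η t ∧ η t ≤ b := by
    cases t with
    | zero => rw [hη0]; exact ⟨hb, le_rfl⟩
    | succ t₁ => rw [hηs]; exact ⟨hp _, hεb _ (by omega)⟩
  obtain ⟨hηpos, hηb⟩ := hη
  set it := k t + 1 - a t with hit
  have hsep : η t ≤ |(Y (K + 1 - i) - W i) - (Y (K + 1 - it) - W it)| := by
    obtain ⟨hW0, hWS⟩ := W_bounds (k := k) hc hθ0 hε hS hW it
    obtain ⟨hW0', hWS'⟩ := W_bounds (k := k) hc hθ0 hε hS hW i
    have hne' : K + 1 - i ≠ K + 1 - it := by have := hks t ht; omega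
    have h1 := hYsep _ _ hne'
    have h2 : |(Y (K + 1 - i) - W i) - (Y (K + 1 - it) - W it)| ≥ |Y (K + 1 - i) - Y (K + 1 - it)| - |W it - W i| := by
      rw [show (Y (K + 1 - i) - W i) - (Y (K + 1 - it) - W it) = (Y (K + 1 - i) - Y (K + 1 - it)) + (W it - W i) by ring]
      have := abs_add_le (Y (K + 1 - i) - Y (K + 1 - it) + (W it - W i)) (-(W it - W i))
      rw [add_neg_cancel_right, abs_neg] at this
      linarith
    have h3 : |W it - W i| ≤ S := abs_sub_le_iff.mpr ⟨by linarith, by linarith⟩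
    have : S = B₀ - b := by rw [hB]; ring
    linarith
  have hy1 := (hV i).2
  have hy2 := (hV it).2
  have hcube := abs_sub_le_cube_mul_abs_invSqrt_sub (hxs.trans_le hy1.1) (hxs.trans_le hy2.1) hy1.2 hy2.2
  refine tent_eq_zero ?_
  rw [hL, hgB, hgB, div_mul_eq_mul_div, le_div_iff₀ hηpos, one_mul]
  exact hsep.trans hcube

end Summit.QuantumFields.BalabanUV.Beta.EriceRemainderEnclosureHistoryRenewalWitness

end
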